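import Summits.Ventures.YMGap.RobustBall.RowsSMassive
import Summits.Ventures.YMGap.RobustBall.LoopActionMember
import HarnessLib

/-!
# Venture YMGap, track ROBUST-BALL (tier 2) — the NORM BALL OF GENERIC WILSON-TYPE LOOP ACTIONS:
# every DLR state of every member is MASSIVE

HONEST FRAMING. WHAT THIS IS: a venture file (cell `pub-ymgap`, track Y2 ROBUST-BALL, seat ds-3): the
MASSIVE reading of rb-p1's `LoopActionMember.lean`. There, a generic Wilson-type loop action
`loopFamilyAction N γ c = ∑_i c_i · Re tr(U_{γ_i})/N` over an ARBITRARY family `γ : ι → ZdLoop d` of closed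
lattice loops (finitely many active loops per carrier) with `‖c‖_w ≤ ε` — the weighted `ℓ¹/ℓ^∞` norm ball
`LoopNormLE w γ c ε`: through every link `e`, `∑_{i : e ∈ γ_i} |c_i| ∑_{y ∈ γ_i} mult_i(y) e^{w‖e − y‖_∞} ≤ ε` — is
shown to lie in the one-parameter tier-2 ball `MemBallZdS (2ε) ε w` (`memBallZdS_loopFamilyAction`). Composing
with the seat's tier-2 massive cells (`RowsSMassive.lean`, door-level readings of rb-p1's certificate
inequalities through `perturbedS_covariance_decay_quasilocal`) gives, cell by cell and BY NAME: the perturbed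
theory has DLR states and EVERY DLR state is an Osterwalder–Seiler MASSIVE STATE (`IsMassiveState`: exponential
clustering of all bounded measurable local observables) with exponentially decaying plaquette–plaquette
correlation function — `SU(2)` on `ℤ⁴` at `β_W = 1/16` for every loop action of norm `‖c‖_{log 2} ≤ 0.143`
(`su2_loopFamily_massive_1_16`), at `β_W = 1/20` for `‖c‖_{log 2} ≤ 0.209` (`su2_loopFamily_massive_1_20`), at
`β_W = 1/16` for `‖c‖_{log (3/2)} ≤ 0.186` (`su2_loopFamily_massive32_1_16`); EVERY `N ≥ 2` at 't Hooft coupling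
`1/64` for `‖c‖_{log (6/5)} ≤ 1/40` (`suN_loopFamily_massive_1_64`, hypothesis-free); `SU(3)` at `β_W = 1/8` for
`‖c‖_{log 2} ≤ 0.116` GIVEN the two certified one-link constants H1/H2 (`su3_loopFamily_massive_1_8`). Schemas:
`su2_loopFamily_massive_of_door` (the hypothesis-free `SU(2)` door `6|β_W| e^{2ε} e^{w} + e^{ε} √(2/3) ε < 1`),
`su2_loopFamily_massive_rowBS` (lineage B numeric majorants, rb-p1's `su2_rowBS` hypotheses verbatim),
`suN_loopFamily_massive_bakryEmery` (all `N ≥ 2`). The one new cell needed, `(1/20, 0.209, 2)` of rb-p1's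
`su2_rowBS2_1_20`, is read massive here (`su2_massiveS_rowBS2_1_20`). DOOR-LEVEL: the hypothesis carried is the
row condition of each cell, not the currency `MassGapOnLoopBall`. WHAT IT IS NOT: no new number (radii are
rb-p1's, certificate lineage rb-ref); strong-coupling lattice statements inside the rows' windows; nothing about
the continuum limit, confinement or the Clay Millennium problem.

References: rb-p1 `LoopActionMember.lean`, `LoopObservable.lean`, `RowsS.lean`, `RowsSN.lean`; ds-3
`RowsSMassive.lean`, `MassGapOnBallZdSMassive.lean`, `SummableMassiveBridge.lean`; K. Osterwalder, E. Seiler,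
Ann. Phys. 110 (1978) 440, §4; K. G. Wilson, Phys. Rev. D 10 (1974) 2445.
-/

noncomputable section

open MeasureTheory ProbabilityTheory Function Finset Filter Topology
open scoped NNReal
open Literature.Probability.LatticeModels
open Literature.MathematicalPhysics.QuantumLattice
open Literature.MathematicalPhysics.QuantumFieldTheory hiding ZdEdge Site
open Literature.Barriers.QuantumFields (IsMassiveState)
open Summit.QuantumFields.BalabanUV.InfraRed.StrongCouplingPoincareDoorSUN (OneLinkPoincareSUN)
open Summit.QuantumFields.BalabanUV.InfraRed.StrongCouplingVarianceDoorSUN (OneLinkVarianceBound)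

namespace Summit.Ventures.YMGap.RobustBall

/-! ### The one new massive cell: `(β⋆_W, ε, q) = (1/20, 0.209, 2)`, lineage B -/

/-- **Row 1g cell `(β⋆_W, ε, q) = (1/20, 0.209, 2)` (lineage B) is a MASSIVE row** (rb-p1 `su2_rowBS2_1_20`, the
cell of the loop-ball radius `0.209` at `β_W = 1/20`): every member of `MemBallZdS 0.418 0.209 (log 2)` added to
`SU(2)` Wilson at `β_W = 1/20` on `ℤ⁴` has DLR states, all massive (rate `log 2`) with plaquette–plaquette decay. -/
theorem su2_massiveS_rowBS2_1_20 {W : Potential (ZdEdge 4) (Matrix.specialUnitaryGroup (Fin 2) ℂ)}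
    (hW : MemBallZdS (2 * (209 / 1000)) (209 / 1000) (Real.log 2) W) :
    (perturbedGibbsMeasuresS (d := 4) (fundamentalRep (Fin 2)) (((2 : ℕ) : ℝ) * ((1 / 20 : ℝ) / 4)) W).Nonempty ∧
      ∀ μ ∈ perturbedGibbsMeasuresS (d := 4) (fundamentalRep (Fin 2)) (((2 : ℕ) : ℝ) * ((1 / 20 : ℝ) / 4)) W,
        IsMassiveState μ ∧ HasExponentialDecay (plaquetteCorrFn (fundamentalRep (Fin 2)) μ) :=
  su2_massiveS_rowBS (by norm_num) (by norm_num) (by norm_num) (by norm_num) (by norm_num) (by norm_num) hW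

variable {N : ℕ} {ι : Type*} {γ : ι → ZdLoop 4} {c : ι → ℝ}

/-! ### Schemas on the loop-action norm ball (`d = 4`) -/

/-- **`SU(2)`, HYPOTHESIS-FREE door on the loop-action norm ball**: for a rate `w > 0` and
`6|β_W| e^{2ε} e^{w} + e^{ε} √(2/3) ε < 1`, EVERY generic Wilson-type loop action with finite carrier fibres and
`‖c‖_w ≤ ε`, added to `SU(2)` Wilson at `β_W` on `ℤ⁴`, has DLR states, and every DLR state is MASSIVE (rate `w`)
with plaquette–plaquette decay (`su2_massive_onBallZdS_dim4` ∘ `memBallZdS_loopFamilyAction`). -/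
theorem su2_loopFamily_massive_of_door {βW w ε : ℝ} (hw : 0 < w)
    (hρ : 6 * |βW| * (Real.exp (2 * ε) * Real.exp w) + Real.exp ε * Real.sqrt (2 / 3) * ε < 1)
    (hfin : ∀ X, {i | walkEdges (γ i).walk = X}.Finite) (h : LoopNormLE w γ c ε) :
    (perturbedGibbsMeasuresS (d := 4) (fundamentalRep (Fin 2)) (((2 : ℕ) : ℝ) * (βW / 4))
        (loopFamilyAction (d := 4) 2 γ c)).Nonempty ∧
      ∀ μ ∈ perturbedGibbsMeasuresS (d := 4) (fundamentalRep (Fin 2)) (((2 : ℕ) : ℝ) * (βW / 4))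
          (loopFamilyAction (d := 4) 2 γ c),
        IsMassiveState μ ∧ HasExponentialDecay (plaquetteCorrFn (fundamentalRep (Fin 2)) μ) := by
  refine su2_massive_onBallZdS_dim4 hw ?_ (memBallZdS_loopFamilyAction hfin h)
  rwa [show (2 : ℝ) * ε / 2 = ε by ring]

/-- **`SU(2)`, lineage-(B) numeric schema on the loop-action norm ball** (the hypotheses of rb-p1's `su2_rowBS`
verbatim: `0 ≤ β_W ≤ 1/6`, `0 ≤ ε ≤ 1/2`, `q > 1`, `3 · 1.732051 · β_W q T(2ε) + T(ε) · 0.8165 · ε < 1` with `T` the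
quartic Taylor majorant): every loop action with finite carrier fibres and `‖c‖_{log q} ≤ ε`, added to `SU(2)`
Wilson at `β_W` on `ℤ⁴`, has DLR states, all MASSIVE (rate `log q`) with plaquette–plaquette decay. -/
theorem su2_loopFamily_massive_rowBS {βW ε q : ℝ} (hq : 1 < q) (hβ : 0 ≤ βW) (hβ6 : βW ≤ 1 / 6) (hε0 : 0 ≤ ε)
    (hε1 : ε ≤ 1 / 2)
    (hcert : 3 * (1732051 / 1000000) * βW * q * (1 + 2 * ε + (2 * ε) ^ 2 / 2 + (2 * ε) ^ 3 / 6 + 5 / 96 * (2 * ε) ^ 4) +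
      (1 + ε + ε ^ 2 / 2 + ε ^ 3 / 6 + 5 / 96 * ε ^ 4) * (8165 / 10000) * ε < 1)
    (hfin : ∀ X, {i | walkEdges (γ i).walk = X}.Finite) (h : LoopNormLE (Real.log q) γ c ε) :
    (perturbedGibbsMeasuresS (d := 4) (fundamentalRep (Fin 2)) (((2 : ℕ) : ℝ) * (βW / 4))
        (loopFamilyAction (d := 4) 2 γ c)).Nonempty ∧
      ∀ μ ∈ perturbedGibbsMeasuresS (d := 4) (fundamentalRep (Fin 2)) (((2 : ℕ) : ℝ) * (βW / 4))
          (loopFamilyAction (d := 4) 2 γ c),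
        IsMassiveState μ ∧ HasExponentialDecay (plaquetteCorrFn (fundamentalRep (Fin 2)) μ) :=
  su2_massiveS_rowBS hq hβ hβ6 hε0 hε1 hcert (memBallZdS_loopFamilyAction hfin h)

/-- **ALL `N ≥ 2`, HYPOTHESIS-FREE Bakry–Émery door on the loop-action norm ball** ('t Hooft coupling `β`,
`6|β| < 1/2`): for `w > 0` and `18|β| e^{2ε} e^{w}/(1/2 − 6|β|) + e^{ε} ε/√(N(1/2 − 6|β|)) < 1`, every loop action with
finite carrier fibres and `‖c‖_w ≤ ε`, added to `SU(N)` Wilson at `β`, has DLR states, all MASSIVE (rate `w`) with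
plaquette–plaquette decay (`suN_massive_onBallZdS_bakryEmery_dim4` ∘ `memBallZdS_loopFamilyAction`). -/
theorem suN_loopFamily_massive_bakryEmery (hN : 2 ≤ N) {β w ε : ℝ} (hw : 0 < w)
    (hb : |β| * (2 * (((4 : ℕ) : ℝ) - 1)) < 1 / 2)
    (hρ : 6 * (((4 : ℕ) : ℝ) - 1) * |β| * (Real.exp (2 * ε) * Real.exp w) / (1 / 2 - |β| * (2 * (((4 : ℕ) : ℝ) - 1))) +
      Real.exp ε * ε / Real.sqrt ((N : ℝ) * (1 / 2 - |β| * (2 * (((4 : ℕ) : ℝ) - 1)))) < 1)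
    {γ : ι → ZdLoop 4} {c : ι → ℝ}
    (hfin : ∀ X, {i | walkEdges (γ i).walk = X}.Finite) (h : LoopNormLE w γ c ε) :
    (perturbedGibbsMeasuresS (d := 4) (fundamentalRep (Fin N)) ((N : ℝ) * β)
        (loopFamilyAction (d := 4) N γ c)).Nonempty ∧
      ∀ μ ∈ perturbedGibbsMeasuresS (d := 4) (fundamentalRep (Fin N)) ((N : ℝ) * β)
          (loopFamilyAction (d := 4) N γ c),
        IsMassiveState μ ∧ HasExponentialDecay (plaquetteCorrFn (fundamentalRep (Fin N)) μ) := by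
  refine suN_massive_onBallZdS_bakryEmery_dim4 hN hw hb ?_ (memBallZdS_loopFamilyAction hfin h)
  rwa [show (2 : ℝ) * ε / 2 = ε by ring]

/-! ### Cells: the landed massive rows read on the loop-action norm ball -/

/-- ★ **`SU(2)`, `d = 4`, `β_W = 1/16`: every loop action of norm `‖c‖_{log 2} ≤ 0.143` is a MASSIVE theory** —
for every generic Wilson-type loop action with finite carrier fibres and
`∑_{i : e ∈ γ_i} |c_i| ∑_{y ∈ γ_i} mult_i(y) 2^{‖e−y‖_∞} ≤ 0.143` through every link `e`, `SU(2)` Wilson at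
`β_W = 1/16` plus the action has DLR states on `ℤ⁴`, and EVERY DLR state is massive (rate `log 2`) with
plaquette–plaquette decay (massive cell `su2_massiveS_rowBS2_1_16`; rb-p1's row `su2_loopFamily_massGapS_1_16`). -/
theorem su2_loopFamily_massive_1_16 (hfin : ∀ X, {i | walkEdges (γ i).walk = X}.Finite)
    (h : LoopNormLE (Real.log 2) γ c (143 / 1000)) :
    (perturbedGibbsMeasuresS (d := 4) (fundamentalRep (Fin 2)) (((2 : ℕ) : ℝ) * ((1 / 16 : ℝ) / 4))
        (loopFamilyAction (d := 4) 2 γ c)).Nonempty ∧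
      ∀ μ ∈ perturbedGibbsMeasuresS (d := 4) (fundamentalRep (Fin 2)) (((2 : ℕ) : ℝ) * ((1 / 16 : ℝ) / 4))
          (loopFamilyAction (d := 4) 2 γ c),
        IsMassiveState μ ∧ HasExponentialDecay (plaquetteCorrFn (fundamentalRep (Fin 2)) μ) :=
  su2_massiveS_rowBS2_1_16 (memBallZdS_loopFamilyAction hfin h)

/-- **`SU(2)`, `d = 4`, `β_W = 1/20`: every loop action of norm `‖c‖_{log 2} ≤ 0.209` is a MASSIVE theory**
(massive cell `su2_massiveS_rowBS2_1_20`; rb-p1's row `su2_loopFamily_massGapS_1_20`). -/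
theorem su2_loopFamily_massive_1_20 (hfin : ∀ X, {i | walkEdges (γ i).walk = X}.Finite)
    (h : LoopNormLE (Real.log 2) γ c (209 / 1000)) :
    (perturbedGibbsMeasuresS (d := 4) (fundamentalRep (Fin 2)) (((2 : ℕ) : ℝ) * ((1 / 20 : ℝ) / 4))
        (loopFamilyAction (d := 4) 2 γ c)).Nonempty ∧
      ∀ μ ∈ perturbedGibbsMeasuresS (d := 4) (fundamentalRep (Fin 2)) (((2 : ℕ) : ℝ) * ((1 / 20 : ℝ) / 4))
          (loopFamilyAction (d := 4) 2 γ c),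
        IsMassiveState μ ∧ HasExponentialDecay (plaquetteCorrFn (fundamentalRep (Fin 2)) μ) :=
  su2_massiveS_rowBS2_1_20 (memBallZdS_loopFamilyAction hfin h)

/-- **`SU(2)`, `d = 4`, `β_W = 1/16`, slower weight `(3/2)^{dist}`: every loop action of norm
`‖c‖_{log (3/2)} ≤ 0.186` is a MASSIVE theory** (rate `log (3/2)`; massive cell `su2_massiveS_rowS32_1_16`; rb-p1's
row `su2_loopFamily_massGapS32_1_16`). -/
theorem su2_loopFamily_massive32_1_16 (hfin : ∀ X, {i | walkEdges (γ i).walk = X}.Finite)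
    (h : LoopNormLE (Real.log (3 / 2)) γ c (93 / 500)) :
    (perturbedGibbsMeasuresS (d := 4) (fundamentalRep (Fin 2)) (((2 : ℕ) : ℝ) * ((1 / 16 : ℝ) / 4))
        (loopFamilyAction (d := 4) 2 γ c)).Nonempty ∧
      ∀ μ ∈ perturbedGibbsMeasuresS (d := 4) (fundamentalRep (Fin 2)) (((2 : ℕ) : ℝ) * ((1 / 16 : ℝ) / 4))
          (loopFamilyAction (d := 4) 2 γ c),
        IsMassiveState μ ∧ HasExponentialDecay (plaquetteCorrFn (fundamentalRep (Fin 2)) μ) :=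
  su2_massiveS_rowS32_1_16 (memBallZdS_loopFamilyAction hfin h)

/-- ★ **EVERY `N ≥ 2`, `d = 4`, 't Hooft coupling `1/64`, HYPOTHESIS-FREE: every loop action of norm
`‖c‖_{log (6/5)} ≤ 1/40` is a MASSIVE theory** — `SU(N)` Wilson at coupling `1/64` plus any generic Wilson-type
loop action with finite carrier fibres and `‖c‖_{log (6/5)} ≤ 1/40` has DLR states on `ℤ⁴`, all massive (rate
`log (6/5)`) with plaquette–plaquette decay, with `N`-uniform radius (massive cell `suN_massiveS_rowS_1_64`,
loads `2ε = 1/20`, `ε = 1/40 ≤ 1/10`; rb-p1's row `suN_loopFamily_massGapS_1_64`). -/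
theorem suN_loopFamily_massive_1_64 (hN : 2 ≤ N) {γ : ι → ZdLoop 4} {c : ι → ℝ}
    (hfin : ∀ X, {i | walkEdges (γ i).walk = X}.Finite) (h : LoopNormLE (Real.log (6 / 5)) γ c (1 / 40)) :
    (perturbedGibbsMeasuresS (d := 4) (fundamentalRep (Fin N)) ((N : ℝ) * (1 / 64))
        (loopFamilyAction (d := 4) N γ c)).Nonempty ∧
      ∀ μ ∈ perturbedGibbsMeasuresS (d := 4) (fundamentalRep (Fin N)) ((N : ℝ) * (1 / 64))
          (loopFamilyAction (d := 4) N γ c),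
        IsMassiveState μ ∧ HasExponentialDecay (plaquetteCorrFn (fundamentalRep (Fin N)) μ) :=
  suN_massiveS_rowS_1_64 hN ((memBallZdS_loopFamilyAction hfin h).mono (by norm_num) (by norm_num))

/-- **`SU(3)`, `d = 4`, `β_W = 1/8`, GIVEN the two certified one-link constants** (H1 `OneLinkPoincareSUN 3 (3/5) (4/5)`,
H2 `OneLinkVarianceBound 3 (11/30) (49/20)`): every loop action of norm `‖c‖_{log 2} ≤ 0.116` is a MASSIVE theory at
`SU(3)` Wilson coupling `β_W = 1/8` (rate `log 2`; massive cell `su3_massiveS_rowS2_1_8` below; rb-p1's row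
`su3_loopFamily_massGapS_1_8`) — CONDITIONAL on H1/H2 exactly like the row. -/
theorem su3_loopFamily_massive_1_8 (hP : OneLinkPoincareSUN 3 (3 / 5) (4 / 5))
    (hV : OneLinkVarianceBound 3 (11 / 30) (49 / 20)) {γ : ι → ZdLoop 4} {c : ι → ℝ}
    (hfin : ∀ X, {i | walkEdges (γ i).walk = X}.Finite) (h : LoopNormLE (Real.log 2) γ c (29 / 250)) :
    (perturbedGibbsMeasuresS (d := 4) (fundamentalRep (Fin 3)) (((3 : ℕ) : ℝ) * ((1 / 8 : ℝ) / 9))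
        (loopFamilyAction (d := 4) 3 γ c)).Nonempty ∧
      ∀ μ ∈ perturbedGibbsMeasuresS (d := 4) (fundamentalRep (Fin 3)) (((3 : ℕ) : ℝ) * ((1 / 8 : ℝ) / 9))
          (loopFamilyAction (d := 4) 3 γ c),
        IsMassiveState μ ∧ HasExponentialDecay (plaquetteCorrFn (fundamentalRep (Fin 3)) μ) :=
  su3_massiveS_row hP hV (q := 2) (by norm_num) (by norm_num) (by norm_num) (by norm_num) (by norm_num) (by norm_num)
    (memBallZdS_loopFamilyAction hfin h)

/-- **`SU(3)` cell (H1/H2) `(β⋆_W, ε, q) = (1/8, 0.116, 2)` is a MASSIVE row** (rb-p1 `su3_rowS2_1_8`, the cell of the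
`SU(3)` loop-ball radius): every member of `MemBallZdS 0.232 0.116 (log 2)` added to `SU(3)` Wilson at `β_W = 1/8` on
`ℤ⁴` has DLR states, all massive (rate `log 2`) with plaquette–plaquette decay, CONDITIONAL on H1/H2. -/
theorem su3_massiveS_rowS2_1_8 (hP : OneLinkPoincareSUN 3 (3 / 5) (4 / 5))
    (hV : OneLinkVarianceBound 3 (11 / 30) (49 / 20)) {W : Potential (ZdEdge 4) (Matrix.specialUnitaryGroup (Fin 3) ℂ)}
    (hW : MemBallZdS (2 * (29 / 250)) (29 / 250) (Real.log 2) W) :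
    (perturbedGibbsMeasuresS (d := 4) (fundamentalRep (Fin 3)) (((3 : ℕ) : ℝ) * ((1 / 8 : ℝ) / 9)) W).Nonempty ∧
      ∀ μ ∈ perturbedGibbsMeasuresS (d := 4) (fundamentalRep (Fin 3)) (((3 : ℕ) : ℝ) * ((1 / 8 : ℝ) / 9)) W,
        IsMassiveState μ ∧ HasExponentialDecay (plaquetteCorrFn (fundamentalRep (Fin 3)) μ) :=
  su3_massiveS_row hP hV (by norm_num) (by norm_num) (by norm_num) (by norm_num) (by norm_num) (by norm_num) hW

/-! ### Wilson-coupling readings (tree coupling `β_W/2` for `SU(2)`) -/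

/-- **Wilson-coupling reading of the headline loop-ball cell**: every DLR state of
`perturbedYMS (fundamentalRep (Fin 2)) (1/32) (loopFamilyAction 2 γ c)` — `SU(2)` at tree coupling `β_W/2 = 1/32`,
i.e. `β_W = 1/16` — with `‖c‖_{log 2} ≤ 0.143` and finite carrier fibres is massive with plaquette–plaquette decay. -/
theorem su2_loopFamily_isMassiveState_1_16_wilson (hfin : ∀ X, {i | walkEdges (γ i).walk = X}.Finite)
    (h : LoopNormLE (Real.log 2) γ c (143 / 1000)) :
    ∀ μ ∈ perturbedGibbsMeasuresS (d := 4) (fundamentalRep (Fin 2)) (1 / 32) (loopFamilyAction (d := 4) 2 γ c),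
      IsMassiveState μ ∧ HasExponentialDecay (plaquetteCorrFn (fundamentalRep (Fin 2)) μ) := by
  have e : (((2 : ℕ) : ℝ) * ((1 / 16 : ℝ) / 4)) = 1 / 32 := by norm_num
  rw [← e]
  exact (su2_loopFamily_massive_1_16 hfin h).2

end Summit.Ventures.YMGap.RobustBall

end
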